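import Summits.ValiantsHypothesis.ValiantsHypothesis.Theorems.FifoMatchingNNDivisionHardExposedFibreRung
import HarnessLib

/-!
# Located faces beyond `C₀^β`, part 2: the McCORMICK body `M_n` is DECIDED by its located face

Theorems-side PORT, part 2 of 3, of `Cruxes/NNDivisionHard/ExposedFibre.lean` REV 3 @3c757fe0c4bc (sha16 fd9e507b00b36db6; author
val-idea-40 g3; critic of record val-idea-crit-9 g1 VERDICT #30: P-P2e PAID, `#print axioms mcCormickLocatedDecided_holds` = std) —
texts VERBATIM, namespace `…Cruxes.NNDivisionHard.ExposedFibre40` ↦ `…Theorems.FifoMatching.ExposedFibre`; see part 1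
(`…ExposedFibreRung`) for the port conventions.  THIS MODULE: §2 the McCormick / rooted-metric body in covariance coordinates
(`mcCormick`), `blockDir_nonpos_on_mcCormick` (the contraction cut `C₀^β` is VALID on `M_n`), the cross-cell gap lemmas
`mcc_cell_gap`, `mcc_cell_gap_le_half`, `mcc_cell_gap_eq_half_iff`, and §2b ★ `mcCormickLocatedDecided_holds` (the workfile's
`McCormickLocatedDecided`, δ-unfolded; definition-free port, see part 1): for every block map `β : [n] → [m]` with a section and blocks of size `≥ 2`,
`HasEFOfSize (COR(K_n) + M_n) r → 3^m ≤ (r+1)·2^m` — two EXACT cuts (`C₀^β`, then the leader/second cross direction), the read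
`funLeft_image_cor_blockFace`, PROP A with one passenger point; with the pairing `β`: `xc(COR(K_n) + M_n) + 1 ≥ 1.5^{⌊n/2⌋}`.
The statement-only items `McCormickExposedFibreBlind` (`M_n ∈ E♭`) and `McCormickBlockEdge` (`M_n ∉ E♯`) stay in the workfile.
Credit: val-idea-40 g3 (W5-P2); the enemy `M_n` was recorded by val-idea-41 (W5-R1).
HONEST FRAMING: helper rows for an OPEN crux; stmt-21181 `NNDivisionHard` OPEN; COR-VIRTUAL OPEN; `VP ≠ VNP` NOT proved; nothing
here is a summit statement.
-/

set_option autoImplicit false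

-- the mandated summit-side namespace repeats a component by design (single-problem summit)
set_option linter.dupNamespace false

noncomputable section

open Matrix Finset
open scoped Pointwise

namespace Summit.ValiantsHypothesis.ValiantsHypothesis.Theorems.FifoMatching.ExposedFibre

open Literature.Barriers.PneNP (HasEFOfSize)
open Literature.Combinatorics.Optimization (corPolytopeGraph corVec)
open Summit.ValiantsHypothesis.ValiantsHypothesis.Theorems.FifoMatching.LocatedFaceExposure
open Summit.ValiantsHypothesis.ValiantsHypothesis.Theorems.FifoMatching.XcDivision

variable {n m : ℕ}

/-! ## §2 The McCormick body is in `E♭ ∖ E♯`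

`M_n = {Y symmetric : 0 ≤ Y_pq ≤ Y_pp ≤ 1, Y_pp + Y_qq − 1 ≤ Y_pq}` (= the rooted metric body `RMET_{n+1}` in
covariance coordinates; budgeted: `xc ≤ 4·n²` facets; in the open core of line rev 8 as typed, val-idea-41 (A)).
* NOT in E♯ (nor E) for ANY `β`: for a block `B` of `β` the functional `−Σ_{p∉B} Y_pp − Σ_{p,q∈B}(Y_pp − Y_pq)` is
  `≤ 0` on `M_n` with equality exactly on the segment `[0, 𝟙_B𝟙_Bᵀ]` — an EDGE with block-constant, non-`J` direction.
* IN E♭ for every `β` whose blocks have size ≥ 2: `face_{C₀^β}(M_n) = {diagonal blocks constant =: y_s, cross cells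
  free in [max(0, y_s+y_t−1), min(y_s, y_t)]}`; a direction `d ⊥ W_β` with symmetrised cross coefficients `d'_pq ≠ 0`
  summing to `0` over each block pair has `max_{face} d·Y = max_y Σ_{s<t} D⁺_{st}·g(y_s, y_t)` with
  `g(a,b) = min(a,b) − max(0,a+b−1) = min(a, b, 1−a, 1−b)` (`mcc_cell_gap`), uniquely maximal at `y ≡ ½`
  (`mcc_cell_gap_le_half`, `mcc_cell_gap_eq_half_iff`); the cross cells are then pinned (`½` where `d' > 0`, `0` where
  `d' < 0`): the exposed fibre of `c = C₀^β + ε d` is ONE VERTEX `Y*`.  So `COR(K_n) + M_n` has the located face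
  `F_β + {Y*}` and `3^m ≤ (r+1)·2^m` — no anchoring (41 (B)/AR1), no KMR (class K). -/

/-- the McCormick / rooted-metric body in `COR` coordinates. -/
def mcCormick (n : ℕ) : Set (Fin n × Fin n → ℝ) :=
  {Y | (∀ p q, Y (p, q) = Y (q, p)) ∧ (∀ p, 0 ≤ Y (p, p) ∧ Y (p, p) ≤ 1) ∧
    ∀ p q, p ≠ q → 0 ≤ Y (p, q) ∧ Y (p, q) ≤ Y (p, p) ∧ Y (p, p) + Y (q, q) - 1 ≤ Y (p, q)}

/-- `C₀^β ≤ 0` on the McCormick body (each pair term `Y_pq − Y_pp ≤ 0`): the contraction cut is VALID on `M_n`,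
so `face_c(COR + M_n) = F_β + face_c(M_n)` for admissible `c` near `C₀^β`. -/
theorem blockDir_nonpos_on_mcCormick (β : Fin n → Fin m) {Y : Fin n × Fin n → ℝ} (hY : Y ∈ mcCormick n) :
    (∑ p : Fin n, ∑ q : Fin n, if β q = β p ∧ q ≠ p then Y (p, q) - Y (p, p) else 0) ≤ 0 := by
  refine Finset.sum_nonpos fun p _ => Finset.sum_nonpos fun q _ => ?_
  split_ifs with h
  · have := (hY.2.2 p q (Ne.symm h.2)).2.1
    linarith
  · exact le_rfl

-- the bounds are the cell's range and are kept in the statement; the identity holds for all reals, so the proof ignores them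
set_option linter.unusedVariables false in
/-- the width of a cross cell of the `C₀^β`-face of `M_n` as a function of the two diagonal values. -/
theorem mcc_cell_gap (a b : ℝ) (ha₀ : 0 ≤ a) (ha₁ : a ≤ 1) (hb₀ : 0 ≤ b) (hb₁ : b ≤ 1) :
    min a b - max 0 (a + b - 1) = min (min a b) (min (1 - a) (1 - b)) := by
  rcases le_total a b with hab | hab <;> rcases le_total 0 (a + b - 1) with h | h <;>
    rcases le_total (1 - a) (1 - b) with h' | h' <;>
    simp only [min_eq_left, min_eq_right, max_eq_left, max_eq_right, hab, h, h', min_def] <;>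
    split_ifs <;> linarith

/-- … it is at most `½` … -/
theorem mcc_cell_gap_le_half (a b : ℝ) : min (min a b) (min (1 - a) (1 - b)) ≤ 1 / 2 := by
  rcases le_total a (1 / 2) with h | h
  · exact (min_le_left _ _).trans ((min_le_left _ _).trans h)
  · exact (min_le_right _ _).trans ((min_le_left _ _).trans (by linarith))

/-- … with equality iff both diagonal values are `½`: the located objective `Σ D⁺_{st}·g(y_s,y_t)` (all `D⁺_{st} > 0`)
has the UNIQUE maximiser `y ≡ ½`. -/
theorem mcc_cell_gap_eq_half_iff (a b : ℝ) :
    min (min a b) (min (1 - a) (1 - b)) = 1 / 2 ↔ a = 1 / 2 ∧ b = 1 / 2 := by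
  constructor
  · intro h
    have h1 : 1 / 2 ≤ a := by rw [← h]; exact (min_le_left _ _).trans (min_le_left _ _)
    have h2 : 1 / 2 ≤ b := by rw [← h]; exact (min_le_left _ _).trans (min_le_right _ _)
    have h3 : 1 / 2 ≤ 1 - a := by rw [← h]; exact (min_le_right _ _).trans (min_le_left _ _)
    have h4 : 1 / 2 ≤ 1 - b := by rw [← h]; exact (min_le_right _ _).trans (min_le_right _ _)
    constructor <;> linarith
  · rintro ⟨rfl, rfl⟩; norm_num

/-! ### §2b `McCormickLocatedDecided` — PROVED (critic price P-P2e, McCormick half): two EXACT cuts, no `ε`: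
`C₀^β` (face `F_β + F'`, `F'` = diagonal blocks constant, `mcc_face_diag`), then the leader/second cross direction
`d(p,q) = [β p ≠ β q]·a_p a_q`, `a = 𝟙_{leaders ρ} − 𝟙_{seconds τ}` (block sums zero ⇒ `d ⊥ W_β`, `dot_eq_zero_on_face`);
on `F'` each block pair contributes `≤ 2·gap ≤ 1` with equality only at `y ≡ ½` and leader cells `½`, so the READ of the
`d`-face is the single point `½·J_m`; PROP A with `K = 1`. -/

/-- on the `C₀^β`-face of `M_n` the diagonal blocks are constant: `Y_pq = Y_pp` within blocks. -/
theorem mcc_face_diag (β : Fin n → Fin m) {B : Fin n × Fin n → ℝ}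
    (hB : ∀ x : Fin n × Fin n → ℝ,
      B ⬝ᵥ x = ∑ p : Fin n, ∑ q : Fin n, if β q = β p ∧ q ≠ p then x (p, q) - x (p, p) else 0)
    {Y : Fin n × Fin n → ℝ} (hY : Y ∈ mcCormick n) (hBY : B ⬝ᵥ Y = 0) :
    ∀ p q, β p = β q → Y (p, q) = Y (p, p) := by
  have hterm : ∀ p q, (if β q = β p ∧ q ≠ p then Y (p, q) - Y (p, p) else 0) ≤ 0 := fun p q => by
    split_ifs with h
    · have := (hY.2.2 p q (Ne.symm h.2)).2.1
      linarith
    · exact le_rfl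
  rw [hB] at hBY
  have hrow := (Finset.sum_eq_zero_iff_of_nonpos fun p _ => Finset.sum_nonpos fun q _ => hterm p q).1 hBY
  intro p q hpq
  by_cases hqp : q = p
  · rw [hqp]
  · have h1 := (Finset.sum_eq_zero_iff_of_nonpos fun q _ => hterm p q).1 (hrow p (Finset.mem_univ _)) q
      (Finset.mem_univ _)
    rw [if_pos ⟨hpq.symm, hqp⟩] at h1
    linarith

open Classical in
/-- ★ **`M_n` is DECIDED by its located face** — `xc(COR(K_n) + M_n) + 1 ≥ 1.5^m` for every `β` with blocks of size
`≥ 2` (so `m = ⌊n/2⌋` with the pairing): no anchoring, no KMR. -/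
theorem mcCormickLocatedDecided_holds :
    ∀ (n m : ℕ) (β : Fin n → Fin m) (ρ : Fin m → Fin n), (∀ t, β (ρ t) = t) →
      (∀ s, 2 ≤ (univ.filter fun p => β p = s).card) → ∀ r : ℕ,
        HasEFOfSize (corPolytopeGraph (⊤ : SimpleGraph (Fin n)) + mcCormick n) r → 3 ^ m ≤ (r + 1) * 2 ^ m := by
  intro n m β ρ hρ hblk r hEF
  rcases Nat.lt_or_ge m 2 with hm | hm
  · interval_cases m
    · simp
    · -- one block: only `r ≥ 1` is claimed; an EF of size 0 would make `COR + M_n` an affine subspace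
      rcases r with _ | r
      · exfalso
        have p₀ : Fin n := ρ 0
        have h0M : (0 : Fin n × Fin n → ℝ) ∈ mcCormick n :=
          ⟨fun _ _ => rfl, fun _ => ⟨le_rfl, zero_le_one⟩, fun _ _ _ => ⟨le_rfl, le_rfl, by simp⟩⟩
        have h0C : (0 : Fin n × Fin n → ℝ) ∈ corPolytopeGraph (⊤ : SimpleGraph (Fin n)) := by
          unfold corPolytopeGraph
          refine subset_convexHull ℝ _ ⟨fun _ => false, ?_⟩
          ext ⟨p, q⟩
          rw [corVec_top_apply]
          simp
        have huC : corVec (⊤ : SimpleGraph (Fin n)) (fun _ => true) ∈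
            corPolytopeGraph (⊤ : SimpleGraph (Fin n)) := by
          unfold corPolytopeGraph
          exact subset_convexHull ℝ _ ⟨fun _ => true, rfl⟩
        have hS0 : (0 : Fin n × Fin n → ℝ) ∈ corPolytopeGraph (⊤ : SimpleGraph (Fin n)) + mcCormick n :=
          ⟨0, h0C, 0, h0M, add_zero 0⟩
        have hSu : corVec (⊤ : SimpleGraph (Fin n)) (fun _ => true) ∈
            corPolytopeGraph (⊤ : SimpleGraph (Fin n)) + mcCormick n :=
          ⟨_, huC, 0, h0M, add_zero _⟩
        obtain ⟨x, hx, Y, hY, hxY⟩ := two_smul_sub_mem_of_hasEFOfSize_zero hEF hS0 hSu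
        have hx0 : 0 ≤ x (p₀, p₀) := by
          unfold corPolytopeGraph at hx
          have h := dot_le_of_mem_convexHull _ (-(Pi.single (p₀, p₀) (1 : ℝ))) 0 (by
            rintro _ ⟨b, rfl⟩
            rw [neg_dotProduct, single_dotProduct, one_mul, corVec_top_apply]
            split_ifs <;> norm_num) x hx
          rw [neg_dotProduct, single_dotProduct, one_mul] at h
          linarith
        have hY0 : 0 ≤ Y (p₀, p₀) := (hY.2.1 p₀).1
        have h := congrFun hxY (p₀, p₀)
        simp only [Pi.add_apply, Pi.sub_apply, Pi.zero_apply, smul_zero, zero_sub, corVec_top_apply] at h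
        simp at h
        linarith
      · rw [pow_one, pow_one]
        omega
  -- main case `m ≥ 2`
  obtain ⟨B, hB⟩ := exists_blockDir β
  have hτex : ∀ s : Fin m, ∃ p, β p = s ∧ p ≠ ρ s := by
    intro s
    obtain ⟨p₁, hp₁, p₂, hp₂, hne⟩ := Finset.one_lt_card.1 (hblk s)
    by_cases h : p₁ = ρ s
    · exact ⟨p₂, (Finset.mem_filter.1 hp₂).2, fun h' => hne (h.trans h'.symm)⟩
    · exact ⟨p₁, (Finset.mem_filter.1 hp₁).2, h⟩
  choose τ hτβ hτne using hτex
  -- cut 1: `C₀^β`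
  have hM1 : ∀ Y ∈ mcCormick n, B ⬝ᵥ Y ≤ 0 := fun Y hY => by
    rw [hB]; exact blockDir_nonpos_on_mcCormick β hY
  have h1 := hEF.face_add_face₁ B 0 0 (blockDir_valid β hB) hM1
  -- the second direction
  obtain ⟨a, ha⟩ : ∃ a : Fin n → ℝ, ∀ p, a p =
      ∑ s : Fin m, ((if p = ρ s then (1 : ℝ) else 0) - (if p = τ s then 1 else 0)) := ⟨_, fun _ => rfl⟩
  obtain ⟨d, hd⟩ : ∃ d : Fin n × Fin n → ℝ, ∀ p q, d (p, q) = if β p = β q then 0 else a p * a q :=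
    ⟨fun pq => if β pq.1 = β pq.2 then 0 else a pq.1 * a pq.2, fun _ _ => rfl⟩
  have hsum_a : ∀ f : Fin n → ℝ, ∑ p, a p * f p = ∑ s, (f (ρ s) - f (τ s)) := by
    intro f
    have h1 : ∀ p, a p * f p = ∑ s, ((if p = ρ s then f p else 0) - (if p = τ s then f p else 0)) := by
      intro p
      rw [ha, Finset.sum_mul]
      refine Finset.sum_congr rfl fun s _ => ?_
      split_ifs <;> ring
    simp_rw [h1]
    rw [Finset.sum_comm]
    refine Finset.sum_congr rfl fun s _ => ?_
    simp [Finset.sum_sub_distrib]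
  -- `d ⊥ W_β`
  have hdw : ∀ w : Fin n × Fin n → ℝ, (∀ p q p' q', β p = β p' → β q = β q' → w (p, q) = w (p', q')) →
      d ⬝ᵥ w = 0 := by
    intro w hw
    have hterm : ∀ p q, d (p, q) * w (p, q) = a p * (a q * (if β p = β q then 0 else w (p, ρ (β q)))) := by
      intro p q
      rw [hd]
      split_ifs with h
      · ring
      · rw [hw p q p (ρ (β q)) rfl (hρ (β q)).symm]
        ring
    show ∑ pq, d pq * w pq = 0
    rw [Fintype.sum_prod_type]
    simp_rw [hterm, ← Finset.mul_sum]
    refine Finset.sum_eq_zero fun p _ => ?_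
    rw [hsum_a]
    simp [hρ, hτβ]
  -- `d ⬝ᵥ Y` as a sum over block pairs
  have hdY : ∀ Y : Fin n × Fin n → ℝ, d ⬝ᵥ Y = ∑ s, ∑ t, if s = t then (0 : ℝ) else
      Y (ρ s, ρ t) - Y (ρ s, τ t) - Y (τ s, ρ t) + Y (τ s, τ t) := by
    intro Y
    have hterm : ∀ p q, d (p, q) * Y (p, q) = a p * (a q * (if β p = β q then 0 else Y (p, q))) := by
      intro p q
      rw [hd]
      split_ifs <;> ring
    show ∑ pq, d pq * Y pq = _
    rw [Fintype.sum_prod_type]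
    simp_rw [hterm, ← Finset.mul_sum]
    rw [hsum_a]
    refine Finset.sum_congr rfl fun s _ => ?_
    rw [hsum_a, hsum_a, ← Finset.sum_sub_distrib]
    refine Finset.sum_congr rfl fun t _ => ?_
    simp only [hρ, hτβ]
    split_ifs <;> ring
  -- the block-pair inequality on `F'` and its equality case
  have hT : ∀ Y ∈ mcCormick n, (∀ p q, β p = β q → Y (p, q) = Y (p, p)) → ∀ s t, s ≠ t →
      Y (ρ s, ρ t) - Y (ρ s, τ t) - Y (τ s, ρ t) + Y (τ s, τ t) ≤ 1 ∧
      (Y (ρ s, ρ t) - Y (ρ s, τ t) - Y (τ s, ρ t) + Y (τ s, τ t) = 1 →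
        Y (ρ s, ρ s) = 1 / 2 ∧ Y (ρ s, ρ t) = 1 / 2) := by
    intro Y hY hdiag s t hst
    have hsym := hY.1
    have hne1 : ρ s ≠ ρ t := fun h => hst (by rw [← hρ s, h, hρ t])
    have hne2 : ρ s ≠ τ t := fun h => hst (by rw [← hρ s, h, hτβ t])
    have hne3 : τ s ≠ ρ t := fun h => hst (by rw [← hτβ s, h, hρ t])
    have hne4 : τ s ≠ τ t := fun h => hst (by rw [← hτβ s, h, hτβ t])
    have hτs : Y (τ s, τ s) = Y (ρ s, ρ s) := by
      rw [← hdiag (τ s) (ρ s) (by rw [hτβ, hρ]), hsym, hdiag (ρ s) (τ s) (by rw [hτβ, hρ])]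
    have hτt : Y (τ t, τ t) = Y (ρ t, ρ t) := by
      rw [← hdiag (τ t) (ρ t) (by rw [hτβ, hρ]), hsym, hdiag (ρ t) (τ t) (by rw [hτβ, hρ])]
    obtain ⟨-, h1b, -⟩ := hY.2.2 _ _ hne1
    obtain ⟨-, h1c, -⟩ := hY.2.2 _ _ hne1.symm
    obtain ⟨h2a, -, h2c⟩ := hY.2.2 _ _ hne2
    obtain ⟨h3a, -, h3c⟩ := hY.2.2 _ _ hne3
    obtain ⟨-, h4b, -⟩ := hY.2.2 _ _ hne4
    obtain ⟨-, h4c, -⟩ := hY.2.2 _ _ hne4.symm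
    rw [hsym (ρ t) (ρ s)] at h1c
    rw [hsym (τ t) (τ s)] at h4c
    rw [hτs] at h4b h3c
    rw [hτt] at h4c h2c
    constructor
    · linarith
    · intro hT1
      constructor <;> linarith
  -- cut 2
  have hMd : ∀ Y ∈ mcCormick n ∩ {Y | B ⬝ᵥ Y = 0},
      d ⬝ᵥ Y ≤ ∑ s : Fin m, ∑ t : Fin m, (if s = t then (0 : ℝ) else 1) := by
    rintro Y ⟨hY, hBY⟩
    have hdiag := mcc_face_diag β hB hY hBY
    rw [hdY]
    refine Finset.sum_le_sum fun s _ => Finset.sum_le_sum fun t _ => ?_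
    split_ifs with hst
    · exact le_rfl
    · exact (hT Y hY hdiag s t hst).1
  have hpt : ∀ Y ∈ mcCormick n ∩ {Y | B ⬝ᵥ Y = 0},
      d ⬝ᵥ Y = ∑ s : Fin m, ∑ t : Fin m, (if s = t then (0 : ℝ) else 1) → ∀ s t, Y (ρ s, ρ t) = 1 / 2 := by
    rintro Y ⟨hY, hBY⟩ hface
    have hdiag := mcc_face_diag β hB hY hBY
    rw [hdY] at hface
    have hle : ∀ s ∈ (Finset.univ : Finset (Fin m)), ∀ t ∈ (Finset.univ : Finset (Fin m)),
        (if s = t then (0 : ℝ) else Y (ρ s, ρ t) - Y (ρ s, τ t) - Y (τ s, ρ t) + Y (τ s, τ t)) ≤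
          (if s = t then (0 : ℝ) else 1) := by
      intro s _ t _
      split_ifs with hst
      · exact le_rfl
      · exact (hT Y hY hdiag s t hst).1
    have hrow := (Finset.sum_eq_sum_iff_of_le fun s hs => Finset.sum_le_sum (hle s hs)).1 hface
    have hcell : ∀ s t, s ≠ t → Y (ρ s, ρ s) = 1 / 2 ∧ Y (ρ s, ρ t) = 1 / 2 := by
      intro s t hst
      have h := (Finset.sum_eq_sum_iff_of_le (hle s (Finset.mem_univ _))).1 (hrow s (Finset.mem_univ _)) t
        (Finset.mem_univ _)
      rw [if_neg hst, if_neg hst] at h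
      exact (hT Y hY hdiag s t hst).2 h
    intro s t
    by_cases hst : s = t
    · subst hst
      obtain ⟨t', ht'⟩ := Fintype.exists_ne_of_one_lt_card (by rw [Fintype.card_fin]; omega) s
      exact (hcell s t' (Ne.symm ht')).1
    · exact (hcell s t hst).2
  -- the pinned vertex `Y*`
  obtain ⟨Ys, hYs⟩ : ∃ Ys : Fin n × Fin n → ℝ, ∀ p q, Ys (p, q) =
      if β p = β q ∨ (p = ρ (β p) ∧ q = ρ (β q)) ∨ (p = τ (β p) ∧ q = τ (β q)) then 1 / 2 else 0 :=
    ⟨fun pq => if β pq.1 = β pq.2 ∨ (pq.1 = ρ (β pq.1) ∧ pq.2 = ρ (β pq.2)) ∨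
      (pq.1 = τ (β pq.1) ∧ pq.2 = τ (β pq.2)) then 1 / 2 else 0, fun _ _ => rfl⟩
  have hYpp : ∀ p, Ys (p, p) = 1 / 2 := fun p => by rw [hYs]; simp
  have hYsM : Ys ∈ mcCormick n := by
    refine ⟨fun p q => ?_, fun p => ?_, fun p q hpq => ?_⟩
    · rw [hYs, hYs]
      refine if_congr ⟨?_, ?_⟩ rfl rfl
      · rintro (h | ⟨h1, h2⟩ | ⟨h1, h2⟩)
        · exact Or.inl h.symm
        · exact Or.inr (Or.inl ⟨h2, h1⟩)
        · exact Or.inr (Or.inr ⟨h2, h1⟩)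
      · rintro (h | ⟨h1, h2⟩ | ⟨h1, h2⟩)
        · exact Or.inl h.symm
        · exact Or.inr (Or.inl ⟨h2, h1⟩)
        · exact Or.inr (Or.inr ⟨h2, h1⟩)
    · rw [hYpp]; norm_num
    · rw [hYpp, hYpp, hYs]
      split_ifs <;> norm_num
  have hYsB : B ⬝ᵥ Ys = 0 := by
    rw [hB]
    refine Finset.sum_eq_zero fun p _ => Finset.sum_eq_zero fun q _ => ?_
    split_ifs with h
    · rw [hYpp, hYs, if_pos (Or.inl h.1.symm)]
      ring
    · rfl
  have hYsd : d ⬝ᵥ Ys = ∑ s : Fin m, ∑ t : Fin m, (if s = t then (0 : ℝ) else 1) := by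
    rw [hdY]
    refine Finset.sum_congr rfl fun s _ => Finset.sum_congr rfl fun t _ => ?_
    split_ifs with hst
    · rfl
    · have e1 : Ys (ρ s, ρ t) = 1 / 2 := by rw [hYs]; simp [hρ]
      have e2 : Ys (ρ s, τ t) = 0 := by rw [hYs]; simp [hρ, hτβ, hst, hτne t, (hτne s).symm]
      have e3 : Ys (τ s, ρ t) = 0 := by rw [hYs]; simp [hρ, hτβ, hst, hτne s, (hτne t).symm]
      have e4 : Ys (τ s, τ t) = 1 / 2 := by rw [hYs]; simp [hτβ]
      rw [e1, e2, e3, e4]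
      norm_num
  -- assemble: second cut, read, PROP A with one passenger point
  have hPd : ∀ x ∈ corPolytopeGraph (⊤ : SimpleGraph (Fin n)) ∩ {x | B ⬝ᵥ x = 0}, d ⬝ᵥ x = 0 :=
    dot_eq_zero_on_face β hB (fun w hw => hdw w (blockConstSym_of_mem_span β hw).2)
  have h2 := h1.face_add_face₁ d 0 _ (fun x hx => (hPd x hx).le) hMd
  have hPeq : (corPolytopeGraph (⊤ : SimpleGraph (Fin n)) ∩ {x | B ⬝ᵥ x = 0}) ∩ {x | d ⬝ᵥ x = 0} =
      corPolytopeGraph (⊤ : SimpleGraph (Fin n)) ∩ {x | B ⬝ᵥ x = 0} :=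
    Set.inter_eq_left.2 fun x hx => hPd x hx
  rw [hPeq] at h2
  have h3 := h2.image_linearMap (LinearMap.funLeft ℝ ℝ (fun ij : Fin m × Fin m => (ρ ij.1, ρ ij.2)))
  rw [Set.image_add, funLeft_image_cor_blockFace β hB hρ] at h3
  have himg : LinearMap.funLeft ℝ ℝ (fun ij : Fin m × Fin m => (ρ ij.1, ρ ij.2)) ''
      ((mcCormick n ∩ {Y | B ⬝ᵥ Y = 0}) ∩
        {Y | d ⬝ᵥ Y = ∑ s : Fin m, ∑ t : Fin m, (if s = t then (0 : ℝ) else 1)}) =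
      convexHull ℝ (Set.range fun _ : Fin 1 => (fun _ : Fin m × Fin m => (1 / 2 : ℝ))) := by
    rw [Set.range_const, convexHull_singleton]
    apply Set.Subset.antisymm
    · rintro _ ⟨Y, ⟨hYF, hface⟩, rfl⟩
      refine Set.mem_singleton_iff.2 (funext fun st => ?_)
      rw [LinearMap.funLeft_apply]
      exact hpt Y hYF hface st.1 st.2
    · intro z hz
      rw [Set.mem_singleton_iff.1 hz]
      refine ⟨Ys, ⟨⟨hYsM, hYsB⟩, hYsd⟩, funext fun st => ?_⟩
      rw [LinearMap.funLeft_apply]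
      obtain ⟨s, t⟩ := st
      by_cases hst : s = t
      · subst hst
        exact hYpp _
      · show Ys (ρ s, ρ t) = 1 / 2
        rw [hYs]; simp [hρ]
  rw [himg] at h3
  have h4 := corPolytopeGraph_top_add_hull_three_pow_le _ (by norm_num) h3
  simpa using h4


end Summit.ValiantsHypothesis.ValiantsHypothesis.Theorems.FifoMatching.ExposedFibre

end
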